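import Summits.CriticalPhenomena.Ising3DConformalLimit.Theses.FKParityRobustness
import Summits.CriticalPhenomena.Ising3DConformalLimit.Theorems.FKParityRobustnessDefs
import Summits.CriticalPhenomena.Ising3DConformalLimit.Theorems.FKParityRobustnessParityRobustMergingXorTransport
import Summits.CriticalPhenomena.Ising3DConformalLimit.Theorems.FKParityRobustnessParityRobustMergingEvenSubgraphCount
import Summits.CriticalPhenomena.Ising3DConformalLimit.Theorems.FKParityRobustnessParityRobustMergingGrimmettJanson
import Summits.CriticalPhenomena.Ising3DConformalLimit.Theorems.FKParityRobustnessParityRobustMergingFKTransfer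
import Literature.Probability.LatticeModels.LoopO1
import Literature.Probability.LatticeModels.RandomCluster

/-!
# Skeleton line `plaquette-xor-surgery` for crux `ParityRobustMerging` (stmt-CriticalPhenomena-11253)

Route `FKParityRobustness`, crux r2 `ParityRobustMerging` = BLOB:
`∃ c > 0 ∀ l ≥ 1 ∃ N₀ ∀ N ≥ N₀ ∀ a = l·tetra ⊂ Λ_N : c·φ_N[all four aᵢ joined] ≤ ∫ u_a dφ_N`,
`φ_N` the free critical FK-Ising measure of the box graph `G_N = (zdGraph 3).comap Subtype.val`
on `↥(box 3 N)`, `u_a(ω)` the fraction of `T`-joins of `A = {aᵢ}` inside `ω` keeping `A` in one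
component.

RESHAPE 2 (line lead `prover-line-stmt-CriticalPhenomena-11253-r-0`, re-seated 2026-08-16).
The vocabulary (`tetra`, `JoinsAll`, `IsPlaquette`, `plaquettes`, `nearTouch`, `pivotals`, `zMass`,
`ntMass`, `pivMass`, `boxGraph`, `tc`, `tetra_injective`, `tanh_criticalBeta_nonneg`, `zMass_nonneg`,
`zMass_split`) now comes from the LANDED vocabulary file `Theorems/FKParityRobustnessDefs.lean`
(p71741, with the registered bookkeeping stub `stub_massSplit`), and the transport identity from the
LANDED `Theorems/FKParityRobustnessParityRobustMergingXorTransport.lean` (p72240, `stub_xorTransport`).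
The former single transfer stub `stub_fkLoopTransfer` is cut into THREE registered stubs along its
proof (all dimension-free finite-sum statements, provable now):

* `stub_evenSubgraphCount` — the cycle-space count `#𝓔_∅(ω) · 2^{|V|} = 2^{|ω| + k(ω)}` for
  `ω ⊆ E(G)` (`k` = number of open clusters, the tree's `clusterCount · ∅`) — LANDED p74171
  (`Theorems/FKParityRobustnessParityRobustMergingEvenSubgraphCount.lean`, imported);
* `stub_grimmettJanson` — LANDED p74442 (`Theorems/…GrimmettJanson.lean`, imported) — GIVEN that count, the sourced Grimmett–Janson identity
  `∑_ω w_{p,2}(ω) · #{F ∈ 𝒯_A(ω) : P F}/#𝓔_∅(ω) = 2^{|V|} (1 − p/2)^{|E|} · ∑_{F ∈ 𝒯_A(G), P F} (p/(2−p))^{|F|}`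
  for every `p ∈ [0,1]`, every source set `A` and every predicate `P` (`w_{p,2}` = `rcWeight G p 2 ∅`);
* `stub_fkLoopTransfer` — LANDED p74891 (`Theorems/…FKTransfer.lean`, imported) — GIVEN that identity, the FK ← loop transfer: `c·Z_{tanh β}(A) ≤ Z_{tanh β}(A;C)`
  implies the crux's inner inequality `c·φ[all joined] ≤ ∫ u_a dφ` verbatim (switching count
  `#𝒯_A(ω) ∈ {0, #𝓔_∅(ω)}`, `{all joined} ⊆ {𝒯_A(ω) ≠ ∅}` by XOR of two pairing paths — needs `a`
  injective, cf. `Negative/LoadBearingHypotheses.lean` —, `tanh β = p/(2−p)` for `p = 1 − e^{−2β}`).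

The two `d = 3` stubs `stub_nearTouch` (NT, load-bearing) and `stub_pivotalSparsity` (PS) are
unchanged.  `ParityRobustMerging_of` composes: `c·Z(A;H) ≤ ntMass = pivMass ≤ max C 0 · Z(A;C)`,
`Z(A) = Z(A;C) + Z(A;H) ≤ (1 + K)·Z(A;C)`, then the transfer at `(↥(box 3 N), G_N, β_c(3))`.

## The line (idea card `plaquette-xor-surgery`, crux-ideate r1; triage r1-1: pass)

Work on the LOOP side.  With `t = tanh β_c(3)` and `𝒯_A(G_N)` the `T`-joins of `A` in `G_N`, the
loop-O(1) masses `Z(A; P) = ∑_{F ∈ 𝒯_A, P F} t^{|F|}` (`zMass`), `C = JoinsAll a`, `H = ¬C`.  By the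
transfer, BLOB follows from the STRONG LOOP FORM `C⁺ : Z(A; C) ≥ c·Z(A)`.  `𝒯_A` is a coset of the
cycle space, so XOR with a plaquette maps `𝒯_A` to itself at weight cost in `[t⁴, t⁻⁴]`; for `F ∈ H`
and a NEAR-TOUCH plaquette `P` (edge-disjoint from `F`, `JoinsAll a (F ∪ P)`) the surgery `F ↦ F ⊔ P`
lands in `C`, and `(F, P) ↦ (F ⊔ P, P)` is a bijection onto the pairs `(F', P)` with `F' ∈ C`,
`P ⊆ F'` a full PIVOTAL plaquette (`¬ JoinsAll a (F' \ P)`): `ntMass = pivMass` (landed).  The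
`d = 3` input: NT `c · Z(A; H) ≤ ntMass` and PS `pivMass ≤ C · Z(A; C)`.

REGIME HONESTY.  NT ∧ PS ⟺ `Z(A;C)/Z(A;H) ≥ c/C` (no slack).  With `x₄` the touching exponent of two
source strands of one critical HT configuration on `ℤ³`: `x₄ > 3` ⇒ NT false (decision card
`cubic-watermelon-watershed` and the disprover predict `x₄ ≈ 3.2`, decay `l^{3−x₄} ≈ l^{−0.2}`);
`x₄ = 3` ⇒ NT, PS both `Θ(1)` — the bet; `x₄ < 3` ⇒ crux true but NT false (given H the clusters
stay apart).  NT refuted ⇏ crux refuted.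

## Disproof used (`Cruxes/ParityRobustMerging/Disproof.lean`, cycle 1, refuter-cdisprove-…-11253-0)

* `parityRobustMerging_false_without_hl` (landed, `Theorems/ParityRobustMerging/Negative/LoadBearingHypotheses.lean`):
  `1 ≤ l` is load-bearing and enters only through the injectivity of `a` — honoured: the transfer
  stub keeps `Function.Injective a` and the composition feeds it `tetra_injective hl`.
* `fkTransfer_false_without_injective` (landed, same file): the transfer without injectivity is
  false — honoured (hypothesis kept; it is used exactly in `{all joined} ⊆ 𝓕_A`).
* § B targets: NT predicted FALSE for `x₄ ≠ 3`, PS predicted true, transfer "correct finite identity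
  chain, no attack" — the split of the transfer into count / identity / transfer follows § B's
  re-derivation (`t = p/(2-p)`, constant fixed by normalisation).
* § C numerics (kit j008214–16, j008062; ideator k=2 jobs j008279–95, j008685–87): pending at
  reshape time; the pre-registered reading rules (Disproof § C, `mc-reading-guide.md`) decide NT.
-/

noncomputable section

open MeasureTheory Finset
open Literature.Probability.LatticeModels
open Summit.CriticalPhenomena.Ising3DConformalLimit.Theses.FKParityRobustness

namespace Summit.CriticalPhenomena.Ising3DConformalLimit.Cruxes.ParityRobustMerging.PlaquetteXorSurgery

open scoped Classical

/-! ### The stub STATEMENTS (named `Prop`s; the registered `stub_*` theorems below restate them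
verbatim, and `Registered.stub_*` are their name-keyed aliases used as hypotheses of
`ParityRobustMerging_of`) -/

/-- Statement of STUB NT (load-bearing): near-touch first moment given the H-pairing, critical
loop O(1) with four tetrahedral sources in large boxes of `ℤ³`. -/
def NearTouch : Prop :=
  ∃ c : ℝ, 0 < c ∧ ∀ l : ℕ, 1 ≤ l → ∃ N₀ : ℕ, ∀ N : ℕ, N₀ ≤ N →
    ∀ a : Fin 4 → ↥(box 3 N), (∀ i, ((a i : Site 3)) = (l : ℤ) • tetra i) →
      c * zMass (boxGraph N) tc a (fun F => ¬ JoinsAll a F) ≤ ntMass (boxGraph N) tc a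

/-- Statement of STUB PS: sparsity of full pivotal plaquettes given that the sources are joined. -/
def PivotalSparsity : Prop :=
  ∃ C : ℝ, ∀ l : ℕ, 1 ≤ l → ∃ N₀ : ℕ, ∀ N : ℕ, N₀ ≤ N →
    ∀ a : Fin 4 → ↥(box 3 N), (∀ i, ((a i : Site 3)) = (l : ℤ) • tetra i) →
      pivMass (boxGraph N) tc a ≤ C * zMass (boxGraph N) tc a (fun F => JoinsAll a F)

/-- Statement of STUB EC (even-subgraph count = dimension of the cycle space): for an edge set
`ω ⊆ E(G)` of a finite graph, `#𝓔_∅(ω) · 2^{|V|} = 2^{|ω| + k(ω)}` where `𝓔_∅(ω) = evenSubgraphs G ω`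
(the even subgraphs of `ω`) and `k(ω) = clusterCount ω ∅` is the number of connected components of
`(V, ω)` (isolated vertices included).  Equivalently `dim_{𝔽₂} (cycle space of ω) = |ω| − |V| + k(ω)`. -/
def EvenSubgraphCount : Prop :=
  ∀ (V : Type) [Fintype V] [DecidableEq V] (G : SimpleGraph V) [DecidableRel G.Adj]
    (ω : Finset (Sym2 V)), ω ⊆ G.edgeFinset →
      #(evenSubgraphs G (↑ω : Set (Sym2 V))) * 2 ^ Fintype.card V =
        2 ^ (#ω + clusterCount (↑ω : Set (Sym2 V)) (∅ : Set V))

/-- Statement of STUB GJ (sourced Grimmett–Janson identity, unnormalised): for `p ∈ [0,1]`, every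
source set `A` and every predicate `P` on edge sets,
`∑_{ω ⊆ E} w_{p,2}(ω) · #{F ∈ 𝒯_A(ω) : P F} / #𝓔_∅(ω) = 2^{|V|} (1 − p/2)^{|E|} · ∑_{F ∈ 𝒯_A(G), P F} (p/(2−p))^{|F|}`,
`w_{p,2}(ω) = p^{|ω|}(1−p)^{|E∖ω|} 2^{k(ω)}` the free `q = 2` random-cluster weight (`rcWeight G p 2 ∅`).
Dividing by `Z_RC` this says: for `ω ∼ φ_{p,2}` and `F` uniform on `𝓔_∅(ω)` (or on `𝒯_A(ω)` when
non-empty), the law of `F` is the (sourced) loop O(1) measure at `t = p/(2−p)`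
(Grimmett–Janson 2009, Thm 3.1; Grimmett 2018, Thm 8.65–8.66; Hansen–Jiang–Klausen 2025, §2). -/
def GrimmettJansonIdentity : Prop :=
  ∀ (V : Type) [Fintype V] [DecidableEq V] (G : SimpleGraph V) [DecidableRel G.Adj] (p : ℝ),
    p ∈ Set.Icc (0 : ℝ) 1 → ∀ (A : Finset V) (P : Finset (Sym2 V) → Prop),
      ∑ ω ∈ G.edgeFinset.powerset,
          rcWeight G p 2 ∅ ω *
            ((#((tJoins G (↑ω : Set (Sym2 V)) A).filter (fun F => P F)) : ℝ) /
              (#(evenSubgraphs G (↑ω : Set (Sym2 V))) : ℝ)) =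
        2 ^ Fintype.card V * (1 - p / 2) ^ #G.edgeFinset *
          ∑ F ∈ (tJoins G Set.univ A).filter (fun F => P F), (p / (2 - p)) ^ #F

/-- Statement of STUB T (the FK ← loop-O(1) transfer), on every finite graph, at every `β ≥ 0`: a
loop-side bound `c·Z(A) ≤ Z(A; C)` at `t = tanh β` gives the crux's FK inequality `c·φ[J] ≤ ∫ u_a dφ`
for `φ = rcMeasure G (fkIsingParam β) 2 ∅` — the conclusion is the crux's inner statement VERBATIM
(including its `Finset`-monad coercion quirk), with `↥(box 3 N)` generalised to `V`. -/
def FKTransfer : Prop :=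
  ∀ (V : Type) [Fintype V] [DecidableEq V] (G : SimpleGraph V) [DecidableRel G.Adj] (β : ℝ),
    0 ≤ β → ∀ a : Fin 4 → V, Function.Injective a → ∀ c : ℝ,
      c * zMass G (Real.tanh β) a (fun _ => True) ≤ zMass G (Real.tanh β) a (fun F => JoinsAll a F) →
  (let φ := Literature.Probability.LatticeModels.rcMeasure G (Literature.Probability.LatticeModels.fkIsingParam β) 2 ∅; let sol : Set (Sym2 V) → Finset (Finset (Sym2 V)) := fun ω => G.edgeFinset.powerset.filter (fun F => (↑F : Set (Sym2 V)) ⊆ ω ∧ ∀ v, Odd (F.filter (fun e => v ∈ e)).card ↔ v ∈ Finset.univ.image a); let u : Set (Sym2 V) → ℝ := fun ω => (((sol ω).filter (fun F => ∀ i j, (SimpleGraph.fromEdgeSet (↑F : Set (Sym2 V))).Reachable (a i) (a j))).card : ℝ) / ((sol ω).card : ℝ); c * φ.real {ω | ∀ i j, (Literature.Probability.Percolation.openGraph ω).Reachable (a i) (a j)} ≤ ∫ ω, u ω ∂φ)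

/-! ### The registered stubs: only the two `d = 3` stubs NT and PS remain open (`sorry`); `stub_massSplit`,
`stub_xorTransport`, `stub_evenSubgraphCount`, `stub_grimmettJanson`, `stub_fkLoopTransfer` are LANDED and
imported from `Theorems/` — the crux is reduced, kernel-checked, to NT ∧ PS (⟹ the loop form `C⁺`). -/

/-- STUB NT (XL, LOAD-BEARING) — `NearTouch`: there is `c > 0` such that for every `l ≥ 1`, all
large `N` and `a = l·tetra`, `c · Z(A; H) ≤ ntMass`, i.e. under the critical sourced loop-O(1)
measure of `Λ_N ⊂ ℤ³` CONDITIONED ON THE H-PAIRING (the two source clusters disjoint), the expected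
number of near-touch plaquettes (empty unit squares with a corner on each source cluster) is
bounded below: `E[#nearTouch | H] ≥ c / t_c⁴`, uniformly in `l`.  Must use `d = 3` (false in
`d = 2`, where the touching exponent is `63/24 > 2`); must not be a box-crossing gluing (barrier
`TransverseCrossingsNeedNotMeet`).  Standing adverse prediction (Disproof § D, decision card
`cubic-watermelon-watershed`): `x₄ ≈ 3.2 > 3`, `E[#nearTouch; H]/Z(A) ≍ l^{3−x₄} → 0`; decided by the
pre-registered Monte-Carlo reading rules (Disproof § C). -/
theorem stub_nearTouch :
    ∃ c : ℝ, 0 < c ∧ ∀ l : ℕ, 1 ≤ l → ∃ N₀ : ℕ, ∀ N : ℕ, N₀ ≤ N →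
      ∀ a : Fin 4 → ↥(box 3 N), (∀ i, ((a i : Site 3)) = (l : ℤ) • tetra i) →
        c * zMass (boxGraph N) tc a (fun F => ¬ JoinsAll a F) ≤ ntMass (boxGraph N) tc a := by
  sorry

/-- STUB PS (L) — `PivotalSparsity`: there is `C` such that for every `l ≥ 1`, all large `N` and
`a = l·tetra`, `pivMass ≤ C · Z(A; C)`, i.e. conditionally on the four sources being joined, the
expected number of FULL PIVOTAL PLAQUETTES (unit squares `P ⊆ F'` whose removal separates the
sources 2|2) is `≤ C`, uniformly in `l` and `N`.  Heuristic: pivotal plaquettes lie in series along a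
chain of otherwise disjoint clusters linked by single full plaquettes, each link costing
`t_c⁴ = 2.26·10⁻³` times a local entropy constant (Peierls-in-`t⁴`); a direct argument is required —
transport alone is circular (triage r1-1 doubt (a)).  Predicted true in every regime (Disproof § B). -/
theorem stub_pivotalSparsity :
    ∃ C : ℝ, ∀ l : ℕ, 1 ≤ l → ∃ N₀ : ℕ, ∀ N : ℕ, N₀ ≤ N →
      ∀ a : Fin 4 → ↥(box 3 N), (∀ i, ((a i : Site 3)) = (l : ℤ) • tetra i) →
        pivMass (boxGraph N) tc a ≤ C * zMass (boxGraph N) tc a (fun F => JoinsAll a F) := by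
  sorry

/-! ### Consistency: each named statement IS its registered stub (definitionally) -/

theorem xorTransport_holds :
    ∀ (V : Type) [Fintype V] [DecidableEq V] (G : SimpleGraph V) [DecidableRel G.Adj]
      (t : ℝ) (a : Fin 4 → V), ntMass G t a = pivMass G t a := stub_xorTransport
theorem massSplit_holds :
    ∀ (V : Type) [Fintype V] [DecidableEq V] (G : SimpleGraph V) [DecidableRel G.Adj]
      (t : ℝ) (a : Fin 4 → V),
      zMass G t a (fun _ => True) = zMass G t a (fun F => JoinsAll a F) + zMass G t a (fun F => ¬ JoinsAll a F) :=
  stub_massSplit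
theorem nearTouch_holds : NearTouch := stub_nearTouch
theorem pivotalSparsity_holds : PivotalSparsity := stub_pivotalSparsity
theorem evenSubgraphCount_holds : EvenSubgraphCount := stub_evenSubgraphCount
theorem grimmettJanson_holds : EvenSubgraphCount → GrimmettJansonIdentity := stub_grimmettJanson
theorem fkTransfer_holds : GrimmettJansonIdentity → FKTransfer := stub_fkLoopTransfer

/-! ### Name-keyed aliases of the open statements (the hypotheses of the composition) -/
namespace Registered

/-- Alias of `NearTouch` keyed by the registered stub name. -/
abbrev stub_nearTouch : Prop := NearTouch
/-- Alias of `PivotalSparsity` keyed by the registered stub name. -/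
abbrev stub_pivotalSparsity : Prop := PivotalSparsity

end Registered

/-! ### The composition: the open stubs (and the two landed ones) imply the crux, by name -/

/-- `ParityRobustMerging` from the stubs (real algebra, no `sorry`).  Constants: from NT's `c > 0`
and PS's `C` put `K := max C 0 / c ≥ 0` and `c⁺ := 1/(1+K)`; `N₀ := max N₀^{NT} N₀^{PS}`.  At
`(N, a)`: `c·Z(A;H) ≤ ntMass = pivMass ≤ max C 0 · Z(A;C)` (NT, the landed `stub_xorTransport`, PS and
`Z ≥ 0` from `tanh β_c ≥ 0`), so `Z(A;H) ≤ K·Z(A;C)` and `Z(A) = Z(A;C) + Z(A;H) ≤ (1+K)·Z(A;C)`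
(landed `stub_massSplit`), i.e. `c⁺·Z(A) ≤ Z(A;C)`; the landed transfer `stub_fkLoopTransfer (stub_grimmettJanson stub_evenSubgraphCount)` at `V = ↥(box 3 N)`,
`G = G_N`, `β = β_c(3) ≥ 0` (`criticalBeta_nonneg`), `a` injective (`tetra_injective`) is then the
crux's inner statement verbatim. -/
theorem ParityRobustMerging_of (hNT : Registered.stub_nearTouch) (hPS : Registered.stub_pivotalSparsity) :
    Summit.CriticalPhenomena.Ising3DConformalLimit.Theses.FKParityRobustness.ParityRobustMerging := by
  have hT' : FKTransfer := stub_fkLoopTransfer (stub_grimmettJanson stub_evenSubgraphCount)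
  obtain ⟨c, hc, hNT⟩ := hNT
  obtain ⟨C, hPS⟩ := hPS
  set K : ℝ := max C 0 / c with hK
  have hK0 : 0 ≤ K := div_nonneg (le_max_right _ _) hc.le
  have hK1 : 0 < 1 + K := by linarith
  unfold ParityRobustMerging
  intro tetra'
  refine ⟨1 / (1 + K), by positivity, fun l hl => ?_⟩
  obtain ⟨N₁, hN₁⟩ := hNT l hl
  obtain ⟨N₂, hN₂⟩ := hPS l hl
  refine ⟨max N₁ N₂, fun N hN a ha => ?_⟩
  have h1 := hN₁ N (le_of_max_le_left hN) a ha
  have h2 := hN₂ N (le_of_max_le_right hN) a ha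
  have hx := stub_xorTransport ↥(box 3 N) (boxGraph N) tc a
  have hzC : 0 ≤ zMass (boxGraph N) tc a (fun F => JoinsAll a F) :=
    zMass_nonneg _ tanh_criticalBeta_nonneg _ _
  have h3 : pivMass (boxGraph N) tc a ≤ max C 0 * zMass (boxGraph N) tc a (fun F => JoinsAll a F) :=
    h2.trans (mul_le_mul_of_nonneg_right (le_max_left _ _) hzC)
  have h4 : zMass (boxGraph N) tc a (fun F => ¬ JoinsAll a F)
      ≤ K * zMass (boxGraph N) tc a (fun F => JoinsAll a F) := by
    rw [hK, div_mul_eq_mul_div, le_div_iff₀ hc]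
    calc zMass (boxGraph N) tc a (fun F => ¬ JoinsAll a F) * c
        = c * zMass (boxGraph N) tc a (fun F => ¬ JoinsAll a F) := by ring
      _ ≤ ntMass (boxGraph N) tc a := h1
      _ = pivMass (boxGraph N) tc a := hx
      _ ≤ max C 0 * zMass (boxGraph N) tc a (fun F => JoinsAll a F) := h3
  have h5 : zMass (boxGraph N) tc a (fun _ => True)
      ≤ (1 + K) * zMass (boxGraph N) tc a (fun F => JoinsAll a F) := by
    rw [stub_massSplit ↥(box 3 N) (boxGraph N) tc a, add_mul, one_mul]
    linarith
  refine hT' ↥(box 3 N) ((zdGraph 3).comap Subtype.val) (criticalBeta 3) (criticalBeta_nonneg 3) a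
    (tetra_injective hl a ha) (1 / (1 + K)) ?_
  rw [one_div, inv_mul_le_iff₀ hK1]
  exact h5

/-- Wiring check: the registered stubs feed `ParityRobustMerging_of` as stated. -/
example : Summit.CriticalPhenomena.Ising3DConformalLimit.Theses.FKParityRobustness.ParityRobustMerging :=
  ParityRobustMerging_of stub_nearTouch stub_pivotalSparsity

end Summit.CriticalPhenomena.Ising3DConformalLimit.Cruxes.ParityRobustMerging.PlaquetteXorSurgery

end
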